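import Summits.BirchSwinnertonDyer.BirchSwinnertonDyer.Theorems.EisensteinPrimesBSDpOnCellCTelescopeBranchLatticeOfFramedRem
import Summits.BirchSwinnertonDyer.BirchSwinnertonDyer.Theorems.ErratumRoadFiveIMCDivMemberCongruenceB2
import Literature.NumberTheory.EllipticCurves.OrdinaryNewformDatumCofreeUnramified
import Summits.BirchSwinnertonDyer.BirchSwinnertonDyer.Theorems.EisensteinPrimesBSDpOnCellCTelescopeBranchIsogenyOfIntertwiner
import HarnessLib

/-!
# [telescope — width x2-p2 g23, 2026-08-30] LEAF N1 FROM FRAMED LATTICE DATA OVER `Γ_ℚ` (the currency of the Galois fact T-An-2ᵍ):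
# restriction `Γ_K → Γ_ℚ` of the three data of N1♭-rem — (unr) from «unramified at every `v ∤ N` of ℚ» via `S₀ := {w ∣ N}`, (fd₀) along the
# tree's `E(ℚ̄)[p^∞] ≃ E_K(K̄)[p^∞]`, (fd_k) by `selfDualCofreeRepOver K = selfDualCofreeRep ∘ res` — and the prefix-agnostic bridge
# `branchLattice_conclusion_of_framed_rat`: N1's v13c/v14 CONCLUSION from `ρ : Γ_ℚ →ₜ* GL₂(ℤ_p⟦X⟧)` + ℚ-level fibre isogenies
# Crux 4 `BSDpOnCellC` (stmt-BirchSwinnertonDyer-19034), line «telescope», leaf N1 `stub_branchLattice` (`--supports`, helper; closes nothing)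

WHY: the cell's Galois fact text (ideator bsd-idea-12 g41, `Cruxes/BSDpOnCellC/T-GAL-FACTTEXT.md` §3: `IsBranchGaloisLattice W p x D ρ` for
`ρ : FramedGaloisRep ℚ (PowerSeries ℤ_[p]) 2`) speaks over `Γ_ℚ`: (G-unr) `∀ v, ℓ_v ∤ N → ρ.IsUnramifiedAt v`, (G-fib₀)/(G-fib_t) fibres against
`W`'s Tate module / `(D t).Δ.selfDualRep`, (G-rat). Leaf N1 and its lattice-level cores N1♭ / N1♭-rem (this seat's #3 / #5) speak over `Γ_K`
(`(W.baseChange K).primaryTorsionGaloisRep p`, `(D k).Δ.selfDualCofreeRepOver K`, `ρ : Γ_K →ₜ* GL₂`). This file is the restriction step, so that the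
chain «T-An-2ᵍ → (g41 H2 + #4: conjugacy ⟹ isogeny) → HERE → #5 → stub_branchLattice» has no gap on the Galois side other than the two target
identifications `(ℚ_p/ℤ_p)² ≃ E[p^∞]` (Tate-module basis) and `(ℚ_p/ℤ_p)² ≃ A_{g_k}†` (under (rat_k)).

CONTENT (namespace `…Theorems.TelescopeBranchLatticeRestrict`; THEOREMS ONLY):
* §1 `finite_setOf_natCast_mem` (`{w | (N : 𝓞 K) ∈ w}` is finite for `N ≠ 0`), `not_dvd_of_natCast_not_mem_under` (`N ∉ w ⇒ ℓ_{w ∩ ℚ} ∤ N`),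
  **`exists_S0_of_isUnramifiedAt_rat`** — (unr♭) for `ρ.restrictField K` with `S₀ := {w ∣ N}` from (G-unr) over ℚ
  (`FramedGaloisRep.isUnramifiedAt_restrictField`).
* §2 **`exists_fd0_restrict`** — an isogeny `e₀ : (ℚ_p/ℤ_p)² → E(ℚ̄)[p^∞]` intertwining `ρ mod X` with `W.primaryTorsionGaloisRep p` over `Γ_ℚ` gives
  one into `E_K(K̄)[p^∞]` intertwining `(ρ.restrictField K) mod X` with `(W.baseChange K).primaryTorsionGaloisRep p` over `Γ_K`, finite kernel and
  cokernel preserved (tree: `RoadFFMember.exists_primaryTorsion_baseChange_equiv`, `ℤ_p`-linear and equivariant).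
* §3 `fdk_restrict_rem` — the member clause restricts termwise (`FramedGaloisRep.restrictField_apply`, `selfDualCofreeRepOver K σ = selfDualCofreeRep (res σ)`).
* §4 **`branchLattice_conclusion_of_framed_rat`** — N1's v13c CONCLUSION (l.440–473, token for token) for the road objects (`‖x k‖ < 1`, `N ≠ 0`)
  from: a topology on `ℤ_p⟦X⟧` (`(C p^k, X^m)` open), `ρ : FramedGaloisRep ℚ ℤ_p⟦X⟧ 2`, (G-unr), an `X = 0` isogeny over `Γ_ℚ`, and for every `k`
  (rat_k) + a remainder presentation `ρ σ = (M σ).map C + (X − C x_k) • U σ` with an isogeny intertwining `M` and `(D k).Δ.selfDualCofreeRep`.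

HONEST FRAMING: by-name plumbing; constructs no Hida family; the ℚ-level data are NOT proved; closes no registered stub, no crux, no summit
statement; BSD is proved for no curve by this file. No named fact, no definition, no instance, no `sorry`.
References (shape only): [cite: Hida1986, Thm. 2.1 (2.2b) (2.2c)] [cite: SerreGaloisCohomology1997, II.§1.1 (restriction to Γ_K)]
-/

set_option autoImplicit false
set_option linter.dupNamespace false

noncomputable section

open scoped Classical MatrixGroups
open NumberField IsDedekindDomain Field PowerSeries Finset
  Literature.NumberTheory.EllipticCurves Literature.NumberTheory.EllipticCurves.GreenbergSelmer
  Literature.NumberTheory.GaloisRepresentations Literature.NumberTheory.IwasawaTheory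
  Literature.NumberTheory.EllipticCurves.BigGaloisRep
  Summit.BirchSwinnertonDyer.BirchSwinnertonDyer.Theorems.TelescopeBranchLatticeOfFramedRem

namespace Summit.BirchSwinnertonDyer.BirchSwinnertonDyer.Theorems.TelescopeBranchLatticeRestrict

/-! ## §1 (unr): from «unramified at every `v ∤ N` of ℚ» to N1's `S₀` over `K` -/

section Unr

variable {K : Type} [Field K] [NumberField K]

/-- The set of places of `K` dividing a non-zero natural number is finite. [folklore] -/
theorem finite_setOf_natCast_mem {N : ℕ} (hN : N ≠ 0) :
    {w : HeightOneSpectrum (𝓞 K) | ((N : ℕ) : 𝓞 K) ∈ w.asIdeal}.Finite := by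
  have hI : (Ideal.span {((N : ℕ) : 𝓞 K)} : Ideal (𝓞 K)) ≠ ⊥ := by
    rw [Ne, Ideal.span_singleton_eq_bot]; exact_mod_cast hN
  refine (Ideal.finite_factors hI).subset fun w hw ↦ ?_
  rw [Set.mem_setOf_eq] at hw ⊢
  exact (Ideal.dvd_span_singleton).mpr hw

/-- If `N ∉ w` then the rational prime below `w` does not divide `N`. [folklore] -/
theorem not_dvd_of_natCast_not_mem_under {N : ℕ} {w : HeightOneSpectrum (𝓞 K)} (hNw : ((N : ℕ) : 𝓞 K) ∉ w.asIdeal) :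
    ¬ ((Rat.HeightOneSpectrum.primesEquiv (w.under (𝓞 ℚ)) : Nat.Primes) : ℕ) ∣ N := by
  set v : HeightOneSpectrum (𝓞 ℚ) := w.under (𝓞 ℚ) with hv
  have hℓw : (((Rat.HeightOneSpectrum.primesEquiv v : Nat.Primes) : ℕ) : 𝓞 K) ∈ w.asIdeal := by
    have h : algebraMap (𝓞 ℚ) (𝓞 K) (((Rat.HeightOneSpectrum.primesEquiv v : Nat.Primes) : ℕ) : 𝓞 ℚ) ∈ w.asIdeal := by
      rw [← Ideal.mem_comap]; exact natCast_primesEquiv_mem_asIdeal v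
    rwa [map_natCast] at h
  rintro ⟨c, hc⟩
  exact hNw (by rw [hc, Nat.cast_mul]; exact w.asIdeal.mul_mem_right _ hℓw)

variable {Λ : Type*} [CommRing Λ] [TopologicalSpace Λ] {n : ℕ}

/-- **(unr♭) over `K` from (G-unr) over `ℚ`**: if the framed `ρ : Γ_ℚ →ₜ* GL_n(Λ)` is unramified at every place `v` of `ℚ` with `ℓ_v ∤ N`
(`N ≠ 0`), then `S₀ := {w : (N : 𝓞 K) ∈ w}` is finite, `ρ|_{Γ_K}` is unramified off `S₀` (`FramedGaloisRep.isUnramifiedAt_restrictField`), and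
trivially `w ∈ S₀ → p ∉ w → N ∈ w` — the (unr) clause of N1 / N1♭ for `ρ.restrictField K`. [cite: Hida1986, Thm. 2.1 (2.2b)] -/
theorem exists_S0_of_isUnramifiedAt_rat (p : ℕ) {N : ℕ} (hN : N ≠ 0) (ρ : FramedGaloisRep ℚ Λ n)
    (hunr : ∀ v : HeightOneSpectrum (𝓞 ℚ), ¬ ((Rat.HeightOneSpectrum.primesEquiv v : Nat.Primes) : ℕ) ∣ N → ρ.IsUnramifiedAt v) :
    ∃ S₀ : Set (HeightOneSpectrum (𝓞 K)), S₀.Finite ∧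
      (∀ w ∉ S₀, ∀ 𝔓 ∈ w.primesAbove, ∀ σ ∈ 𝔓.inertia (Field.absoluteGaloisGroup K), (ρ.restrictField K) σ = 1) ∧
      ∀ w ∈ S₀, ((p : ℕ) : 𝓞 K) ∉ w.asIdeal → ((N : ℕ) : 𝓞 K) ∈ w.asIdeal := by
  refine ⟨{w | ((N : ℕ) : 𝓞 K) ∈ w.asIdeal}, finite_setOf_natCast_mem hN, fun w hw ↦ ?_, fun w hw _ ↦ hw⟩
  exact ρ.isUnramifiedAt_restrictField (w := w) (v := w.under (𝓞 ℚ)) rfl (hunr _ (not_dvd_of_natCast_not_mem_under hw))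

end Unr

/-! ## §2 (fd₀): the `X = 0` isogeny restricted to `Γ_K`, target `E_K(K̄)[p^∞]` -/

section Fd0

variable {p : ℕ} [Fact p.Prime] (W : WeierstrassCurve ℚ) (K : Type) [Field K] [NumberField K] {n : ℕ}
  [TopologicalSpace (PowerSeries ℤ_[p])]

/-- **(fd₀♭) over `K` from an `X = 0` isogeny over `ℚ`**: compose `e₀ : (ℚ_p/ℤ_p)ⁿ → E(ℚ̄)[p^∞]` (ℤ_p-linear, intertwining the reduction
`ρ mod X` with `W.primaryTorsionGaloisRep p` over `Γ_ℚ`, finite kernel and cokernel) with the tree's `ℤ_p`-linear `Γ_K`-equivariant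
`θ : E(ℚ̄)[p^∞] ≃ E_K(K̄)[p^∞]` (`RoadFFMember.exists_primaryTorsion_baseChange_equiv`). [cite: SerreGaloisCohomology1997, II.§1.1] -/
theorem exists_fd0_restrict (ρ : FramedGaloisRep ℚ (PowerSeries ℤ_[p]) n)
    (h : ∃ e₀ : (Fin n → QpModZp p) →+ PrimaryTorsion W.geomPoints p,
      (∀ (c : ℤ_[p]) (v : Fin n → QpModZp p), e₀ (c • v) = c • e₀ v) ∧
      (∀ (σ : Field.absoluteGaloisGroup ℚ) (v : Fin n → QpModZp p),
        e₀ (fun i ↦ ∑ j, PowerSeries.constantCoeff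
          (((ρ σ : GL (Fin n) (PowerSeries ℤ_[p])) : Matrix (Fin n) (Fin n) (PowerSeries ℤ_[p])) i j) • v j) =
          W.primaryTorsionGaloisRep p σ (e₀ v)) ∧
      Finite e₀.ker ∧ Finite (PrimaryTorsion W.geomPoints p ⧸ e₀.range)) :
    ∃ e₀ : (Fin n → QpModZp p) →+ PrimaryTorsion (W.baseChange K).geomPoints p,
      (∀ (c : ℤ_[p]) (v : Fin n → QpModZp p), e₀ (c • v) = c • e₀ v) ∧
      (∀ (σ : Field.absoluteGaloisGroup K) (v : Fin n → QpModZp p),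
        e₀ (fun i ↦ ∑ j, PowerSeries.constantCoeff
          (((ρ.restrictField K σ : GL (Fin n) (PowerSeries ℤ_[p])) : Matrix (Fin n) (Fin n) (PowerSeries ℤ_[p])) i j) • v j) =
          (W.baseChange K).primaryTorsionGaloisRep p σ (e₀ v)) ∧
      Finite e₀.ker ∧ Finite (PrimaryTorsion (W.baseChange K).geomPoints p ⧸ e₀.range) := by
  obtain ⟨e₀, hlin, heq, hker, hcoker⟩ := h
  obtain ⟨θ, hθ⟩ := Summit.BirchSwinnertonDyer.Rank1Residual.X11b.RoadFFMember.exists_primaryTorsion_baseChange_equiv W p K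
  refine ⟨θ.toAddMonoidHom.comp e₀, fun c v ↦ ?_, fun σ v ↦ ?_, ?_, ?_⟩
  · change θ (e₀ (c • v)) = c • θ (e₀ v)
    rw [hlin, LinearEquiv.map_smul]
  · change θ (e₀ _) = (W.baseChange K).primaryTorsionGaloisRep p σ (θ (e₀ v))
    rw [FramedGaloisRep.restrictField_apply, heq, hθ]
  · haveI := hker
    exact TelescopeBranchIsogenyOfIntertwiner.finite_ker_comp_of_injective e₀ θ.toAddMonoidHom hker θ.injective
  · haveI := hcoker
    have hrange : (θ.toAddMonoidHom.comp e₀).range = e₀.range.map θ.toAddMonoidHom := AddMonoidHom.range_comp _ _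
    rw [hrange]
    exact Finite.of_equiv _ (QuotientAddGroup.congr e₀.range (e₀.range.map θ.toAddMonoidHom) θ.toAddEquiv rfl).toEquiv

end Fd0

/-! ## §3 (fd_k): the member clause restricts termwise -/

section Fdk

variable {p : ℕ} [Fact p.Prime] {W : WeierstrassCurve ℚ} [W.IsGloballyMinimal] (K : Type) [Field K] [NumberField K]
  [TopologicalSpace (PowerSeries ℤ_[p])]

/-- **(fd_k♭-rem) over `K` from the member clause over `ℚ`**: the remainder presentation and the intertwining isogeny restrict along
`Γ_K → Γ_ℚ` (`(ρ.restrictField K) σ = ρ (res σ)`, `Δ.selfDualCofreeRepOver K σ = Δ.selfDualCofreeRep (res σ)`). [cite: Hida1986, Thm. 2.1 (2.2c)] -/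
theorem fdk_restrict_rem (ρ : FramedGaloisRep ℚ (PowerSeries ℤ_[p]) 2) (Dk : Skinner2016.HidaCongruentForm W p 1) (c : ℤ_[p])
    (h : ∃ (M : Field.absoluteGaloisGroup ℚ → Matrix (Fin 2) (Fin 2) ℤ_[p])
        (U : Field.absoluteGaloisGroup ℚ → Matrix (Fin 2) (Fin 2) (PowerSeries ℤ_[p])),
        (∀ σ : Field.absoluteGaloisGroup ℚ, ((ρ σ : GL (Fin 2) (PowerSeries ℤ_[p])) : Matrix (Fin 2) (Fin 2) (PowerSeries ℤ_[p])) =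
          (M σ).map (PowerSeries.C (R := ℤ_[p])) + (PowerSeries.X - PowerSeries.C c : PowerSeries ℤ_[p]) • U σ) ∧
      ∃ e : (Fin 2 → QpModZp p) →+ Cofree Dk.Δ.selfDualRep (padicCoeffField Dk.ι),
        (∀ (a : ℤ_[p]) (v : Fin 2 → QpModZp p), e (a • v) = algebraMap ℤ_[p] (padicCoeffIntegers Dk.ι) a • e v) ∧
        (∀ (σ : Field.absoluteGaloisGroup ℚ) (v : Fin 2 → QpModZp p),
          e (fun i ↦ ∑ j, M σ i j • v j) = Dk.Δ.selfDualCofreeRep σ (e v)) ∧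
        Finite e.ker ∧ Finite (Cofree Dk.Δ.selfDualRep (padicCoeffField Dk.ι) ⧸ e.range)) :
    ∃ (M : Field.absoluteGaloisGroup K → Matrix (Fin 2) (Fin 2) ℤ_[p])
        (U : Field.absoluteGaloisGroup K → Matrix (Fin 2) (Fin 2) (PowerSeries ℤ_[p])),
        (∀ σ : Field.absoluteGaloisGroup K,
          ((ρ.restrictField K σ : GL (Fin 2) (PowerSeries ℤ_[p])) : Matrix (Fin 2) (Fin 2) (PowerSeries ℤ_[p])) =
          (M σ).map (PowerSeries.C (R := ℤ_[p])) + (PowerSeries.X - PowerSeries.C c : PowerSeries ℤ_[p]) • U σ) ∧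
      ∃ e : (Fin 2 → QpModZp p) →+ Cofree Dk.Δ.selfDualRep (padicCoeffField Dk.ι),
        (∀ (a : ℤ_[p]) (v : Fin 2 → QpModZp p), e (a • v) = algebraMap ℤ_[p] (padicCoeffIntegers Dk.ι) a • e v) ∧
        (∀ (σ : Field.absoluteGaloisGroup K) (v : Fin 2 → QpModZp p),
          e (fun i ↦ ∑ j, M σ i j • v j) = Dk.Δ.selfDualCofreeRepOver K σ (e v)) ∧
        Finite e.ker ∧ Finite (Cofree Dk.Δ.selfDualRep (padicCoeffField Dk.ι) ⧸ e.range) := by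
  obtain ⟨M, U, hM, e, hlin, heq, hker, hcoker⟩ := h
  refine ⟨fun σ ↦ M (absGaloisRestrict ℚ K σ), fun σ ↦ U (absGaloisRestrict ℚ K σ), fun σ ↦ ?_, e, hlin, fun σ v ↦ ?_, hker, hcoker⟩
  · rw [FramedGaloisRep.restrictField_apply, hM]
  · rw [heq]; rfl

end Fdk

/-! ## §4 The bridge from ℚ-level framed data -/

set_option maxHeartbeats 1600000 in
/-- **Leaf N1's conclusion from framed lattice data OVER `Γ_ℚ`** (the currency of T-An-2ᵍ, fibres as isogenies, members in remainder form): for the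
road objects (`W p N K κ 𝔭bar x D`, `‖x k‖ < 1`, `N ≠ 0`), a topology on `ℤ_p⟦X⟧` with `(C p^k, X^m)` open, `ρ : FramedGaloisRep ℚ ℤ_p⟦X⟧ 2`
unramified at every `v ∤ N`, an `X = 0` isogeny `(ℚ_p/ℤ_p)² → E(ℚ̄)[p^∞]` over `Γ_ℚ`, and for every `k` (rat_k) with a remainder presentation at
`x_k` and an isogeny `(ℚ_p/ℤ_p)² → A_{g_k}†` intertwining `M` with `(D k).Δ.selfDualCofreeRep` — THE CONCLUSION OF N1 (v13c l.440–473) holds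
(§1–§3 + `TelescopeBranchLatticeOfFramedRem.branchLattice_conclusion_of_framed_rem` for `ρ.restrictField K`).
[cite: Hida1986, Thm. 2.1 (2.2b) (2.2c)] [cite: SerreGaloisCohomology1997, II.§1.1] -/
theorem branchLattice_conclusion_of_framed_rat
    (W : WeierstrassCurve ℚ) [W.IsElliptic] [W.IsGloballyMinimal] (p : ℕ) [Fact p.Prime]
    (N : ℕ) (hN : N ≠ 0) (K : Type) [Field K] [NumberField K] (κ : ZpExtension K p) (𝔭bar : HeightOneSpectrum (𝓞 K))
    (x : ℕ → ℤ_[p]) (D : ℕ → Skinner2016.HidaCongruentForm W p 1) (hx : ∀ k, ‖x k‖ < 1)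
    (τΛ : TopologicalSpace (PowerSeries ℤ_[p])) (hR : IsTopologicalRing (PowerSeries ℤ_[p]))
    (hΛ : ∀ k m : ℕ, IsOpen ((Ideal.span {PowerSeries.C ((p : ℤ_[p]) ^ k), (PowerSeries.X : PowerSeries ℤ_[p]) ^ m} :
      Ideal (PowerSeries ℤ_[p])) : Set (PowerSeries ℤ_[p])))
    (ρ : FramedGaloisRep ℚ (PowerSeries ℤ_[p]) 2)
    (hunr : ∀ v : HeightOneSpectrum (𝓞 ℚ), ¬ ((Rat.HeightOneSpectrum.primesEquiv v : Nat.Primes) : ℕ) ∣ N → ρ.IsUnramifiedAt v)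
    (hfd₀ : ∃ e₀ : (Fin 2 → QpModZp p) →+ PrimaryTorsion W.geomPoints p,
      (∀ (c : ℤ_[p]) (v : Fin 2 → QpModZp p), e₀ (c • v) = c • e₀ v) ∧
      (∀ (σ : Field.absoluteGaloisGroup ℚ) (v : Fin 2 → QpModZp p),
        e₀ (fun i ↦ ∑ j, PowerSeries.constantCoeff
          (((ρ σ : GL (Fin 2) (PowerSeries ℤ_[p])) : Matrix (Fin 2) (Fin 2) (PowerSeries ℤ_[p])) i j) • v j) =
          W.primaryTorsionGaloisRep p σ (e₀ v)) ∧
      Finite e₀.ker ∧ Finite (PrimaryTorsion W.geomPoints p ⧸ e₀.range))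
    (hfd : ∀ k : ℕ, Function.Surjective (algebraMap ℤ_[p] (padicCoeffIntegers (D k).ι)) ∧
      ∃ (M : Field.absoluteGaloisGroup ℚ → Matrix (Fin 2) (Fin 2) ℤ_[p])
        (U : Field.absoluteGaloisGroup ℚ → Matrix (Fin 2) (Fin 2) (PowerSeries ℤ_[p])),
        (∀ σ : Field.absoluteGaloisGroup ℚ, ((ρ σ : GL (Fin 2) (PowerSeries ℤ_[p])) : Matrix (Fin 2) (Fin 2) (PowerSeries ℤ_[p])) =
          (M σ).map (PowerSeries.C (R := ℤ_[p])) + (PowerSeries.X - PowerSeries.C (x k) : PowerSeries ℤ_[p]) • U σ) ∧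
      ∃ e : (Fin 2 → QpModZp p) →+ Cofree (D k).Δ.selfDualRep (padicCoeffField (D k).ι),
        (∀ (c : ℤ_[p]) (v : Fin 2 → QpModZp p), e (c • v) = algebraMap ℤ_[p] (padicCoeffIntegers (D k).ι) c • e v) ∧
        (∀ (σ : Field.absoluteGaloisGroup ℚ) (v : Fin 2 → QpModZp p),
          e (fun i ↦ ∑ j, M σ i j • v j) = (D k).Δ.selfDualCofreeRep σ (e v)) ∧
        Finite e.ker ∧ Finite (Cofree (D k).Δ.selfDualRep (padicCoeffField (D k).ι) ⧸ e.range)) :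
    ∃ (_ : TopologicalSpace (PowerSeries ℤ_[p])) (A₂ : Type) (_ : AddCommGroup A₂)
        (_ : Module (PowerSeries ℤ_[p]) A₂) (_ : TopologicalSpace A₂) (_ : DiscreteTopology A₂)
        (ρ₂ : ContinuousRep (Field.absoluteGaloisGroup K) (PowerSeries ℤ_[p]) A₂)
        (_ : TopologicalSpace (PowerSeries (PowerSeries ℤ_[p]))) (_ : IsTopologicalRing (PowerSeries (PowerSeries ℤ_[p])))
        (_ : ContinuousSMul (PowerSeries (PowerSeries ℤ_[p])) (BigRepModule (PowerSeries ℤ_[p]) p A₂))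
        (_ : Module (PowerSeries ℤ_[p]) (XBig κ ρ₂ 𝔭bar (∅ : Set (HeightOneSpectrum (𝓞 K)))))
        (_ : IsScalarTower (PowerSeries ℤ_[p]) (PowerSeries (PowerSeries ℤ_[p]))
          (XBig κ ρ₂ 𝔭bar (∅ : Set (HeightOneSpectrum (𝓞 K))))),
        (Literature.NumberTheory.IwasawaTheory.Greenberg2016.IsCofree (PowerSeries ℤ_[p]) A₂ ∧
          (∀ a : A₂, ∃ n : ℕ, (PowerSeries.X : PowerSeries ℤ_[p]) ^ n • a = 0) ∧
          (∀ a : A₂, ∃ b : A₂, (PowerSeries.X : PowerSeries ℤ_[p]) • b = a) ∧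
          (∀ (k : ℕ) (a : A₂), ∃ b : A₂, (PowerSeries.X - PowerSeries.C (x k)) • b = a) ∧
          (∃ S₀ : Set (HeightOneSpectrum (𝓞 K)), S₀.Finite ∧ GaloisRep.IsUnramifiedOutside S₀ ρ₂ ∧
            ∀ w ∈ S₀, ((p : ℕ) : 𝓞 K) ∉ w.asIdeal → ((N : ℕ) : 𝓞 K) ∈ w.asIdeal) ∧
          (∃ θ₀ : Submodule.torsionBy (PowerSeries ℤ_[p]) A₂ (PowerSeries.X : PowerSeries ℤ_[p]) →+
              PrimaryTorsion (W.baseChange K).geomPoints p,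
            (∀ (c : ℤ_[p]) (a : Submodule.torsionBy (PowerSeries ℤ_[p]) A₂ (PowerSeries.X : PowerSeries ℤ_[p])),
                θ₀ (PowerSeries.C c • a) = c • θ₀ a) ∧
            (∀ (σ : Field.absoluteGaloisGroup K)
                (a : Submodule.torsionBy (PowerSeries ℤ_[p]) A₂ (PowerSeries.X : PowerSeries ℤ_[p])),
                θ₀ (BigGaloisRep.torsionRep ρ₂ (PowerSeries.X : PowerSeries ℤ_[p]) σ a) =
                  (W.baseChange K).primaryTorsionGaloisRep p σ (θ₀ a)) ∧
            Finite θ₀.ker ∧ Finite (PrimaryTorsion (W.baseChange K).geomPoints p ⧸ θ₀.range)) ∧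
          (∀ k : ℕ, Function.Surjective (algebraMap ℤ_[p] (padicCoeffIntegers (D k).ι)) ∧
            ∃ θ : Submodule.torsionBy (PowerSeries ℤ_[p]) A₂ (PowerSeries.X - PowerSeries.C (x k)) →+
                Cofree (D k).Δ.selfDualRep (padicCoeffField (D k).ι),
              (∀ (c : ℤ_[p])
                  (a : Submodule.torsionBy (PowerSeries ℤ_[p]) A₂ (PowerSeries.X - PowerSeries.C (x k))),
                  θ (PowerSeries.C c • a) = algebraMap ℤ_[p] (padicCoeffIntegers (D k).ι) c • θ a) ∧
              (∀ (σ : Field.absoluteGaloisGroup K)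
                  (a : Submodule.torsionBy (PowerSeries ℤ_[p]) A₂ (PowerSeries.X - PowerSeries.C (x k))),
                  θ (BigGaloisRep.torsionRep ρ₂ (PowerSeries.X - PowerSeries.C (x k)) σ a) =
                    (D k).Δ.selfDualCofreeRepOver K σ (θ a)) ∧
              Finite θ.ker ∧ Finite (Cofree (D k).Δ.selfDualRep (padicCoeffField (D k).ι) ⧸ θ.range))) := by
  exact branchLattice_conclusion_of_framed_rem W p N K κ 𝔭bar x D hx τΛ hR hΛ (ρ.restrictField K)
    (exists_S0_of_isUnramifiedAt_rat p hN ρ hunr) (exists_fd0_restrict W K ρ hfd₀)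
    fun k ↦ ⟨(hfd k).1, fdk_restrict_rem K ρ (D k) (x k) (hfd k).2⟩

end Summit.BirchSwinnertonDyer.BirchSwinnertonDyer.Theorems.TelescopeBranchLatticeRestrict
end
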